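/-
Copyright (c) 2026 the pub-hodgecm-mathlib formalisation cell (harness21).  Prover seat hodgecm-mathlib-F0P2-p01 (g17): road «S3-ram» (LEAD F0P3a-plan (g13);
owner F0P3a-p06), (Cnt2′) route B (chair F0P3a-p07 (g15) RULINGS (17)∕(18)), organ «(K2-aniso-res) THE RESIDUAL FRAME OF THE ANISOTROPIC LITERAL» (F0P3-p01 (g19) «want»
05:43:38Z for `stub_Zpair_pm_odd_A`; A-p16 (g33) `stub_Zaniso_zero_odd_A`); 2026-09-02.
-/
import Literature.NumberTheory.Rogawski1990.DepthZeroKappaTransferTypeTwoRamifiedDepthParity       -- ★ (B-p14 lineage): `TypeTwoRamifiedDepth.not_isSquare_trace_sq_sub_four_det_of_not_exists_isRoot`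
import Literature.NumberTheory.Automorphic.UnitaryLatticeTreeResidualEigenframeRamified            -- ★ G3⁶ (F0P3a-p02): `exists_residualGL_of_isIntMatrix`, `StdForm.over_map'`; brings `residue_map_sigma_eq`, `map_coe_mem_integer`, `residue_eq_zero_iff_v_lt_one`
import Literature.NumberTheory.Automorphic.UnitaryLatticeTreeAxisEndoFrame                          -- ★ (z1-a) p847645: `endoGL`, `coe_endoGL_sub_one_eq_endoShape`
import Literature.NumberTheory.Automorphic.UnitaryLatticeTreeResidualTokens                          -- ★ (F0P2-p06): `exists_unit_v_add_mul_norm_mul_lt_one_iff_quadraticChar` (the `hanis` ↦ `χ(−d̄₀d̄₁)` dictionary)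
import Literature.NumberTheory.Automorphic.UnitaryLatticeTreeStabilizer                              -- ★ `mapGL_stdLattice_eq_iff` (`P·𝒪³ = 𝒪³ ⟺ P, P⁻¹` integral)
import Literature.NumberTheory.Automorphic.UnitaryGroupRankOneBigCell                                -- ★ `UnitaryGroup.antidiagonal_three_over_eq` (`J₀ = !![0,0,1;0,1,0;1,0,0]`, `det J₀ = −1`) (ED. 2)
import HarnessLib

/-!
# The anisotropic root block at odd depth: the RESIDUAL FRAME `(Ā, Ȳ, B, δ)` of `P·ι(γ₁, u)·P⁻¹`, residual symmetry, residual irreducibility at the tie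
# (Kottwitz 1986 §3; Rogawski 1990 §4.9; Bruhat–Tits 1972 §10)

Topic `NumberTheory/Rogawski1990`; namespace `Literature.NumberTheory.Rogawski1990.TypeOneRamifiedJunction`.  THEOREMS ONLY (no definition, no instance, no notation, no named
fact, no `sorry`); kernel lane `--supports stmt-HodgeConjecture-24833`; datum-free (`K` with `Valued K ℤᵐ⁰`, `σ` valuation-preserving and residually trivial, `σϖ = −ϖ`).
Cell `pub/hodgecm-mathlib` (D-0151), crux H413; road «S3-ram» (count-neutral).  The anisotropic twin of ★ `DepthZeroKappaTransferTypeTwoRamifiedHyperbolicRootResidual`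
(F0P3a-p01 (g18), p849462): it is the `K → 𝓀` reduction sitting between the lattice halves ★ `rootRegionPackage_anisotropic_of_lineCounts` (p849483) ∘ ★
`ncard_rootChildren_{null,class,negClass}_eq_natCard` (p849383) and the FINITE census ★ `TypeTwoBlockRoot.natCard_params_blockFrame_null_eq'` ∕
`two_mul_natCard_params_blockFrame_quadraticChar_eq'` (F0P3a-p02 (g18), p849444) for the cells `stub_Zaniso_zero_odd_A` (A-p16 (g33)) and `stub_Zpair_pm_odd_A`
(assembler F0P3-p01 (g19)).

THE MATHEMATICS.  The anisotropic literal of the `J₀`-model is `γ = P·ι(γ₁, u)·P⁻¹` with a frame `P ∈ GL₃(K)`, `P·𝒪³ = 𝒪³` (so `P, P⁻¹ ∈ M₃(𝒪)`) and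
`ᵗσ(P)·J₀·P = H♭ = ι(diag(d₀, d₁), η)` (`|dᵢ| = |η| = 1`, `diag d̄` anisotropic), `γ₁ ∈ U(σ, diag d)`, `|γ₁ − 1| ≤ |ϖ|^{d₀}`, `|u₀₀ − 1| < |ϖ|^{d₀}`, `d₀` ODD.  Then:
* (§1, generic `2 × 2`) **the residual discriminant is a NON-SQUARE UNIT at the tie**: if `χ_{γ₁}` has no root in `K`, `|tr² − 4det|(γ₁) = |ϖ|^{2d₀}` and principal units are
  squares, then for the integral leading matrix `T = (ϖ^{d₀})⁻¹(γ₁ − 1)`: `|z² − ((T₀₀ − T₁₁)² + 4T₀₁T₁₀)| = 1` for all integral `z`, i.e. `χ((T̄₀₀ − T̄₁₁)² + 4T̄₀₁T̄₁₀) = −1`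
  (`forall_v_sq_sub_leadingDisc_eq_one`, `quadraticChar_residue_leadingDisc_eq_neg_one`; ★ p849462's `forall_v_sq_sub_four_mul_eq_one` without its hyperbolic `hdiag`);
* (§2) **odd-depth δ-SYMMETRY**: for `γ₁ ∈ U(σ, diag d)` at odd depth, `d̄₀·T̄₀₁ = d̄₁·T̄₁₀` (`residue_diag_mul_leading_offDiag_eq_of_odd`; entry `(0,1)` of `ᵗσ(γ₁)·diag d·γ₁ = diag d`
  with `σ(ϖ^{d₀}) = −ϖ^{d₀}`);
* (§3) **THE RESIDUAL FRAME** (`exists_residualFrame_of_coe_eq_conj_endoGL`): there are `Ā ∈ GL₃(𝓀)` (the residue of `P`, ★ `exists_residualGL_of_isIntMatrix`), the integral leading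
  matrices `Y₀ = (ϖ^{d₀})⁻¹(γ − 1) ∈ M₃(𝒪)`, `T ∈ M₂(𝒪)`, `δ = (d̄₀, η̄, d̄₁)` and `B = Ā⁻¹ȲĀ ∈ M₃(𝓀)` with **`ᵗĀ·J̄₀·Ā = diag δ`** (`σ̄ = id`), all `δ_m ≠ 0`, **`χ(−δ₀δ₂) = −1`** (the
  root plane is ANISOTROPIC, ★ `exists_unit_v_add_mul_norm_mul_lt_one_iff_quadraticChar` on `hanis₀`), **`B = ι(T̄, 0)`** entrywise (`B₁₀ = B₁₂ = B₀₁ = B₂₁ = 0`, `B₁₁ = 0` since the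
  `u`-line is deeper, `B₀₀ = T̄₀₀`, `B₀₂ = T̄₀₁`, `B₂₀ = T̄₁₀`, `B₂₂ = T̄₁₁`) and the self-adjointness **`δ₀B₀₂ = δ₂B₂₀`** — i.e. the `(A, Y, B, δ; i₀ j l) = (Ā, Ȳ, B, δ; 1 0 2)`
  inputs and the `hG hY hB₁–hB₄ hadj` binders of ★ p849444, with `δ` pinned to the residues of `d₀, η, d₁` (conjuncts keyed on `𝒪`-representatives, ★ p849383 style).
* (§4, ED. 2) **THE DISCRIMINANT CLASS OF THE RESIDUAL FRAME**: `χ(δ₀δ₁δ₂) = χ(−1)` for ANY `Ā ∈ GL₃(𝓀)` with `ᵗĀ·J̄₀·Ā = diag δ` (`det J̄₀ = −1`), the key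
  `χ(η̄·d̄₀·d̄₁) = χ(−1)` of A-p16 (g33)'s `anisotropicRootCensus_params_odd_ram` (`quadraticChar_prod_eq_quadraticChar_neg_one_of_frame`, finite-field only).
HONEST LABEL: HC_CM is proved only modulo the 2 remaining named inputs (hLiu418 24832, h413 24833) until rung 0 closes; nothing printed is asserted here (residual bookkeeping over ★
results); «S3-ram» is Literature seeding, count-neutral.

## References
* [Kottwitz1986] R. E. Kottwitz, *Base change for unit elements of Hecke algebras*, Compositio Math. 60 (1986), §3 (the residual datum of a fixed lattice).
* [Rogawski1990] J. D. Rogawski, *Automorphic Representations of Unitary Groups in Three Variables*, Ann. of Math. Stud. 123 (1990), §4.8 Case (a) p. 53, §4.9 Prop. 4.9.1 (b) p. 55, Lemma 4.9.3 p. 56.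
* [BruhatTits1972] F. Bruhat, J. Tits, *Groupes réductifs sur un corps local I*, Publ. Math. IHÉS 41 (1972), §10 (reduction of vertex stabilisers).
* [LabesseLanglands1979] J.-P. Labesse, R. P. Langlands, *L-indistinguishability for SL(2)*, Canad. J. Math. 31 (1979), §2 Lemma 2.1.
* [Serre1979] J.-P. Serre, *Local Fields*, GTM 67 (1979), Ch. II §4 Prop. 7 (Hensel for squares).
* [IrelandRosen1990] K. Ireland, M. Rosen, *A Classical Introduction to Modern Number Theory*, GTM 84, Ch. 8 §1.
-/

set_option autoImplicit false

noncomputable section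

open scoped Valued WithZero Matrix MatrixGroups
open Matrix
open Literature.NumberTheory.Automorphic Literature.NumberTheory.Automorphic.HermitianLattice Literature.NumberTheory.Automorphic.UnitaryLatticeTree
open Literature.NumberTheory.Rogawski1990.TypeTwoRamifiedDepth

namespace Literature.NumberTheory.Rogawski1990.TypeOneRamifiedJunction

variable {K : Type*} [Field K] [Valued K ℤᵐ⁰] {σ : K →+* K} {ϖ : K}

/-! ## §1 The residual discriminant of an anisotropic block at the tie is a non-square unit -/

/-- `tr² − 4det` of `g` is `ϖ^{2m}·((T₀₀ − T₁₁)² + 4T₀₁T₁₀)` for the leading matrix `T = (ϖ^m)⁻¹(g − 1)`. [cite: Kottwitz1986, §3] -/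
theorem trace_sq_sub_four_det_eq_of_leadingMatrix (hϖ0 : ϖ ≠ 0) (g : Matrix (Fin 2) (Fin 2) K) {m : ℕ} (T : Matrix (Fin 2) (Fin 2) 𝒪[K])
    (hT : ∀ i j, ((T i j : 𝒪[K]) : K) = (ϖ ^ m)⁻¹ * ((g - 1) i j)) :
    g.trace ^ 2 - 4 * g.det = (ϖ ^ m) ^ 2 * ((((T 0 0 : 𝒪[K]) : K) - ((T 1 1 : 𝒪[K]) : K)) ^ 2 + 4 * (((T 0 1 : 𝒪[K]) : K) * ((T 1 0 : 𝒪[K]) : K))) := by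
  have hg : ∀ i j, g i j = (1 : Matrix (Fin 2) (Fin 2) K) i j + ϖ ^ m * ((T i j : 𝒪[K]) : K) := fun i j => by
    rw [hT, mul_inv_cancel_left₀ (pow_ne_zero _ hϖ0), Matrix.sub_apply]; ring
  rw [Matrix.trace_fin_two, Matrix.det_fin_two, hg 0 0, hg 1 1, hg 0 1, hg 1 0]
  simp only [Matrix.one_apply_eq, Matrix.one_apply_ne (show (1 : Fin 2) ≠ 0 by decide), Matrix.one_apply_ne (show (0 : Fin 2) ≠ 1 by decide)]
  ring

/-- **IRREDUCIBILITY AT THE TIE ⇒ THE RESIDUAL DISCRIMINANT `(T̄₀₀ − T̄₁₁)² + 4T̄₀₁T̄₁₀` IS A NON-SQUARE UNIT** (generic `2 × 2`, no symmetry assumed): if `χ_g` has no root in `K`,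
`|tr² − 4det|(g) = |ϖ|^{2m}` (the tie: regimes A-odd ∕ C) and principal units are squares (`hsq`), then `|z² − ((T₀₀ − T₁₁)² + 4T₀₁T₁₀)| = 1` for every integral `z` — Hensel would
otherwise make `tr² − 4det = ϖ^{2m}·Δ` a square and give `χ_g` a root. [cite: Rogawski1990, §4.9 p. 55] [cite: Serre1979, Ch. II §4 Prop. 7] [cite: Kottwitz1986, §3] -/
theorem forall_v_sq_sub_leadingDisc_eq_one (h2 : Valued.v (2 : K) = 1) (hsq : ∀ t : K, Valued.v (t - 1) < 1 → IsSquare t)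
    (hϖ : Valued.v ϖ = WithZero.exp (-1 : ℤ)) (g : Matrix (Fin 2) (Fin 2) K)
    (hirr : ¬ ∃ x : K, (g.charpoly).IsRoot x) {m : ℕ}
    (hdisc : Valued.v (g.trace ^ 2 - 4 * g.det) = Valued.v ϖ ^ (2 * m))
    (T : Matrix (Fin 2) (Fin 2) 𝒪[K]) (hT : ∀ i j, ((T i j : 𝒪[K]) : K) = (ϖ ^ m)⁻¹ * ((g - 1) i j)) :
    ∀ z : K, Valued.v z ≤ 1 → Valued.v (z ^ 2 - ((((T 0 0 : 𝒪[K]) : K) - ((T 1 1 : 𝒪[K]) : K)) ^ 2 + 4 * (((T 0 1 : 𝒪[K]) : K) * ((T 1 0 : 𝒪[K]) : K)))) = 1 := by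
  have hϖ0 : ϖ ≠ 0 := fun h0 => by rw [h0, map_zero] at hϖ; exact WithZero.coe_ne_zero hϖ.symm
  have h20 : (2 : K) ≠ 0 := fun h0 => by rw [h0, map_zero] at h2; exact zero_ne_one h2
  obtain ⟨Δ, hΔdef⟩ : ∃ Δ : K, Δ = (((T 0 0 : 𝒪[K]) : K) - ((T 1 1 : 𝒪[K]) : K)) ^ 2 + 4 * (((T 0 1 : 𝒪[K]) : K) * ((T 1 0 : 𝒪[K]) : K)) := ⟨_, rfl⟩
  have hΔ := trace_sq_sub_four_det_eq_of_leadingMatrix hϖ0 g T hT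
  rw [← hΔdef] at hΔ
  have hvΔ : Valued.v Δ = 1 := by
    have h := hdisc
    rw [hΔ, map_mul, map_pow, map_pow, ← pow_mul, mul_comm m 2] at h
    have hne : Valued.v ϖ ^ (2 * m) ≠ 0 := pow_ne_zero _ ((Valuation.ne_zero_iff _).2 hϖ0)
    calc Valued.v Δ = (Valued.v ϖ ^ (2 * m))⁻¹ * (Valued.v ϖ ^ (2 * m) * Valued.v Δ) := by rw [inv_mul_cancel_left₀ hne]
      _ = 1 := by rw [h, inv_mul_cancel₀ hne]
  have hnsq : ¬ IsSquare Δ := by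
    rintro ⟨r, hr⟩
    refine not_isSquare_trace_sq_sub_four_det_of_not_exists_isRoot h20 _ hirr ⟨ϖ ^ m * r, ?_⟩
    rw [hΔ, hr]; ring
  rw [← hΔdef]
  intro z hz
  have hΔint : Valued.v Δ ≤ 1 := hvΔ.le
  have hle : Valued.v (z ^ 2 - Δ) ≤ 1 := by
    refine (Valuation.map_sub _ _ _).trans (max_le ?_ hΔint)
    rw [map_pow]; exact pow_le_one₀ zero_le hz
  refine hle.lt_or_eq.resolve_left fun hlt => hnsq ?_
  -- `|Δ − z²| < 1`, so `z` is a unit and `Δ∕z²` a principal unit, hence a square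
  have hdz : Valued.v (Δ - z ^ 2) < 1 := by rw [← Valuation.map_neg, neg_sub]; exact hlt
  have hvz : Valued.v (z ^ 2) = 1 := by
    have e : z ^ 2 = Δ - (Δ - z ^ 2) := by ring
    rw [e, Valuation.map_sub_eq_of_lt_left _ (by rw [hvΔ]; exact hdz), hvΔ]
  have hz0 : z ^ 2 ≠ 0 := fun h0 => by rw [h0, map_zero] at hvz; exact zero_ne_one hvz
  have hq : Valued.v (Δ / z ^ 2 - 1) < 1 := by
    rw [show Δ / z ^ 2 - 1 = (Δ - z ^ 2) / z ^ 2 by rw [sub_div, div_self hz0], map_div₀, hvz, div_one]; exact hdz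
  obtain ⟨r, hr⟩ := hsq _ hq
  exact ⟨r * z, by rw [show Δ = Δ / z ^ 2 * z ^ 2 by rw [div_mul_cancel₀ _ hz0], hr]; ring⟩

/-- Residual form: **`χ((T̄₀₀ − T̄₁₁)² + 4T̄₀₁T̄₁₀) = −1`** — the residual characteristic polynomial of `T̄` is IRREDUCIBLE (the `hirr` binder of ★ p849444's heads with
`B_jj = T̄₀₀`, `B_ll = T̄₁₁`, `B_jl = T̄₀₁`, `B_lj = T̄₁₀`). [cite: Rogawski1990, §4.9 p. 55] [cite: IrelandRosen1990, Ch. 8 §1] -/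
theorem quadraticChar_residue_leadingDisc_eq_neg_one [Fintype 𝓀[K]] [DecidableEq 𝓀[K]] (h2 : Valued.v (2 : K) = 1)
    (hsq : ∀ t : K, Valued.v (t - 1) < 1 → IsSquare t) (hϖ : Valued.v ϖ = WithZero.exp (-1 : ℤ)) (g : Matrix (Fin 2) (Fin 2) K)
    (hirr : ¬ ∃ x : K, (g.charpoly).IsRoot x) {m : ℕ}
    (hdisc : Valued.v (g.trace ^ 2 - 4 * g.det) = Valued.v ϖ ^ (2 * m))
    (T : Matrix (Fin 2) (Fin 2) 𝒪[K]) (hT : ∀ i j, ((T i j : 𝒪[K]) : K) = (ϖ ^ m)⁻¹ * ((g - 1) i j)) :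
    quadraticChar 𝓀[K] ((IsLocalRing.residue 𝒪[K] (T 0 0) - IsLocalRing.residue 𝒪[K] (T 1 1)) ^ 2 +
        4 * (IsLocalRing.residue 𝒪[K] (T 0 1) * IsLocalRing.residue 𝒪[K] (T 1 0))) = -1 := by
  have h4 := forall_v_sq_sub_leadingDisc_eq_one h2 hsq hϖ g hirr hdisc T hT
  have e0 : (IsLocalRing.residue 𝒪[K] (T 0 0) - IsLocalRing.residue 𝒪[K] (T 1 1)) ^ 2 + 4 * (IsLocalRing.residue 𝒪[K] (T 0 1) * IsLocalRing.residue 𝒪[K] (T 1 0)) =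
      IsLocalRing.residue 𝒪[K] ((T 0 0 - T 1 1) ^ 2 + 4 * (T 0 1 * T 1 0)) := by
    simp only [map_add, map_sub, map_mul, map_pow, map_ofNat]
  rw [e0, quadraticChar_neg_one_iff_not_isSquare]
  rintro ⟨r, hr⟩
  obtain ⟨r₀, rfl⟩ := IsLocalRing.residue_surjective r
  rw [← map_mul, ← sub_eq_zero, ← map_sub, residue_eq_zero_iff_v_lt_one] at hr
  have h := h4 (r₀ : K) r₀.2
  have e : (r₀ : K) ^ 2 - ((((T 0 0 : 𝒪[K]) : K) - ((T 1 1 : 𝒪[K]) : K)) ^ 2 + 4 * (((T 0 1 : 𝒪[K]) : K) * ((T 1 0 : 𝒪[K]) : K))) =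
      -((((T 0 0 - T 1 1) ^ 2 + 4 * (T 0 1 * T 1 0) - r₀ * r₀ : 𝒪[K]) : 𝒪[K]) : K) := by
    have h4 : ((4 : 𝒪[K]) : K) = 4 := rfl
    push_cast; rw [h4]; ring
  rw [e, Valuation.map_neg] at h
  exact (ne_of_lt hr) h

/-! ## §2 Odd-depth unitarity for the anisotropic block: `diag(d̄)·T̄` is symmetric -/

/-- **ODD-DEPTH δ-SYMMETRY**: for `g ∈ U(σ, diag d)` with leading matrix `T` at ODD depth `m` (`σ(ϖ^m) = −ϖ^m`, `σ` residually trivial): `d̄₀·T̄₀₁ = d̄₁·T̄₁₀` — the `(0,1)`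
entry of `ᵗσ(g)·diag d·g = diag d` reads `d₀T₀₁ − d₁σ(T₁₀) = ϖ^m(…)`.  (The `hadj` binder of ★ p849444; `diagonal d` twin of ★ p849462's `v_leading_diag_sub_lt_one`.)
[cite: LabesseLanglands1979, §2] [cite: Kottwitz1986, §3] [cite: Rogawski1990, §4.9 Lemma 4.9.3 p. 56] -/
theorem residue_diag_mul_leading_offDiag_eq_of_odd (hvσ : ∀ a, Valued.v (σ a) = Valued.v a) (hσϖ : σ ϖ = -ϖ) (hϖ : Valued.v ϖ = WithZero.exp (-1 : ℤ))
    (hres : ∀ x : K, Valued.v x ≤ 1 → Valued.v (σ x - x) < 1)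
    {d : Fin 2 → K} (hd : ∀ i, Valued.v (d i) = 1)
    (g : Matrix (Fin 2) (Fin 2) K) (hg : (g.map σ)ᵀ * Matrix.diagonal d * g = Matrix.diagonal d)
    {m : ℕ} (hodd : Odd m) (T : Matrix (Fin 2) (Fin 2) 𝒪[K]) (hT : ∀ i j, ((T i j : 𝒪[K]) : K) = (ϖ ^ m)⁻¹ * ((g - 1) i j))
    (d₀ d₁ : 𝒪[K]) (hd₀ : (d₀ : K) = d 0) (hd₁ : (d₁ : K) = d 1) :
    IsLocalRing.residue 𝒪[K] d₀ * IsLocalRing.residue 𝒪[K] (T 0 1) = IsLocalRing.residue 𝒪[K] d₁ * IsLocalRing.residue 𝒪[K] (T 1 0) := by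
  have hϖ0 : ϖ ≠ 0 := fun h0 => by rw [h0, map_zero] at hϖ; exact WithZero.coe_ne_zero hϖ.symm
  have hϖD0 : (ϖ ^ m : K) ≠ 0 := pow_ne_zero _ hϖ0
  have hϖ1 : Valued.v ϖ < 1 := by rw [hϖ, ← WithZero.exp_zero]; exact WithZero.exp_lt_exp.2 (by norm_num)
  have hϖDlt : Valued.v (ϖ ^ m) < 1 := by rw [map_pow]; exact pow_lt_one₀ zero_le hϖ1 (Nat.pos_iff_ne_zero.1 hodd.pos)
  have hTv : ∀ i j, Valued.v ((T i j : 𝒪[K]) : K) ≤ 1 := fun i j => (T i j).2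
  have hTσ : ∀ i j, Valued.v (σ ((T i j : 𝒪[K]) : K)) ≤ 1 := fun i j => by rw [hvσ]; exact hTv i j
  have hent : ∀ i j, g i j = (1 : Matrix (Fin 2) (Fin 2) K) i j + ϖ ^ m * ((T i j : 𝒪[K]) : K) := fun i j => by
    rw [hT, mul_inv_cancel_left₀ hϖD0, Matrix.sub_apply]; ring
  have h00 := hent 0 0; have h01 := hent 0 1; have h10 := hent 1 0; have h11 := hent 1 1
  simp only [Matrix.one_apply_eq, Matrix.one_apply_ne (show (0 : Fin 2) ≠ 1 by decide),
    Matrix.one_apply_ne (show (1 : Fin 2) ≠ 0 by decide), zero_add] at h00 h01 h10 h11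
  have hσϖD : σ (ϖ ^ m) = -(ϖ ^ m) := by rw [map_pow, hσϖ, hodd.neg_pow]
  have hu01 := congrArg (fun A => A 0 1) hg
  simp only [Matrix.mul_apply, Fin.sum_univ_two, Matrix.transpose_apply, Matrix.map_apply, Matrix.diagonal_apply_eq,
    Matrix.diagonal_apply_ne _ (show (0 : Fin 2) ≠ 1 by decide), Matrix.diagonal_apply_ne _ (show (1 : Fin 2) ≠ 0 by decide),
    mul_zero, add_zero, zero_add] at hu01
  simp only [h00, h01, h10, h11, map_add, map_one, map_mul, hσϖD] at hu01
  have k01 : d 0 * ((T 0 1 : 𝒪[K]) : K) - d 1 * σ ((T 1 0 : 𝒪[K]) : K) =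
      ϖ ^ m * (d 0 * σ ((T 0 0 : 𝒪[K]) : K) * ((T 0 1 : 𝒪[K]) : K) + d 1 * σ ((T 1 0 : 𝒪[K]) : K) * ((T 1 1 : 𝒪[K]) : K)) := by
    apply mul_left_cancel₀ hϖD0
    linear_combination hu01
  have hsym : Valued.v (d 0 * ((T 0 1 : 𝒪[K]) : K) - d 1 * ((T 1 0 : 𝒪[K]) : K)) < 1 := by
    have e : d 0 * ((T 0 1 : 𝒪[K]) : K) - d 1 * ((T 1 0 : 𝒪[K]) : K) =
        (d 0 * ((T 0 1 : 𝒪[K]) : K) - d 1 * σ ((T 1 0 : 𝒪[K]) : K)) + d 1 * (σ ((T 1 0 : 𝒪[K]) : K) - ((T 1 0 : 𝒪[K]) : K)) := by ring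
    rw [e]
    refine (Valued.v.map_add _ _).trans_lt (max_lt ?_ ?_)
    · rw [k01, map_mul]
      refine mul_lt_one_of_lt_of_le hϖDlt ((Valued.v.map_add _ _).trans (max_le ?_ ?_))
      · rw [map_mul, map_mul, hd 0, one_mul]; exact mul_le_one' (hTσ 0 0) (hTv 0 1)
      · rw [map_mul, map_mul, hd 1, one_mul]; exact mul_le_one' (hTσ 1 0) (hTv 1 1)
    · rw [map_mul, hd 1, one_mul]; exact hres _ (hTv 1 0)
  rw [← map_mul, ← map_mul]
  refine residue_eq_of_v_sub_lt_one ?_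
  push_cast
  rw [hd₀, hd₁]
  exact hsym

/-! ## §3 The residual frame `(Ā, Ȳ, B, δ)` of the anisotropic literal `P·ι(γ₁, u)·P⁻¹` -/

set_option maxHeartbeats 1600000 in
-- budget only: block-matrix bookkeeping over `𝒪` and `𝓀`.
/-- **THE RESIDUAL FRAME OF THE ANISOTROPIC LITERAL.**  `γ = P·ι(γ₁, u)·P⁻¹ ∈ U(σ, J₀)` with `ᵗσ(P)J₀P = ι(diag d, η)` (`|dᵢ| = |η| = 1`, `diag d̄` anisotropic via
`hanis₀`), `P·𝒪³ = 𝒪³`, `γ₁ ∈ U(σ, diag d)`, ODD `d₀`, `|γ₁ − 1| ≤ |ϖ|^{d₀}`, `|u₀₀ − 1| < |ϖ|^{d₀}`; `d₀', d₁', η'` any `𝒪`-representatives of `d₀, d₁, η`.  Then there are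
`Ā ∈ GL₃(𝓀)`, integral leading matrices `Y₀ = (ϖ^{d₀})⁻¹(γ − 1)`, `T = (ϖ^{d₀})⁻¹(γ₁ − 1)` and `B ∈ M₃(𝓀)` with: `ᵗĀ·J̄₀·Ā = diag(d̄₀, η̄, d̄₁)` (all non-zero),
`χ(−d̄₀d̄₁) = −1` (ANISOTROPIC root plane), `Ā⁻¹·Ȳ·Ā = B = ι(T̄, 0)` entrywise, and `d̄₀·B₀₂ = d̄₁·B₂₀` — the `(A, Y, B, δ; i₀ j l) := (Ā, Ȳ, B, ![d̄₀, η̄, d̄₁]; 1 0 2)` data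
and the `hG hY hB₁ hB₂ hB₃ hB₄ hadj` binders of ★ `TypeTwoBlockRoot.natCard_params_blockFrame_null_eq'` ∕ `two_mul_natCard_params_blockFrame_quadraticChar_eq'` (p849444);
`hirr` there is §1 `quadraticChar_residue_leadingDisc_eq_neg_one` at the tie (rewrite `B₀₀ B₂₂ B₀₂ B₂₀` by the `T̄` clauses); the `Y₀, hY₀` pair is the one of ★ p849383.
[cite: Kottwitz1986, §3] [cite: BruhatTits1972, §10] [cite: Rogawski1990, §4.8 Case (a) p. 53, §4.9 Prop. 4.9.1 (b) p. 55] [cite: LabesseLanglands1979, §2 Lemma 2.1] -/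
theorem exists_residualFrame_of_coe_eq_conj_endoGL [Fintype 𝓀[K]] [DecidableEq 𝓀[K]]
    (hvσ : ∀ a, Valued.v (σ a) = Valued.v a) (hres : ∀ x : K, Valued.v x ≤ 1 → Valued.v (σ x - x) < 1) (hσϖ : σ ϖ = -ϖ)
    (hϖ : Valued.v ϖ = WithZero.exp (-1 : ℤ))
    {d : Fin 2 → K} {η : K} (hd : ∀ i, Valued.v (d i) = 1) (hη : Valued.v η = 1)
    (hanis₀ : ∀ c : K, Valued.v c ≤ 1 → Valued.v (d 0 + d 1 * (σ c * c)) = 1)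
    (P : GL (Fin 3) K)
    (hP : formCongr σ P ((StdForm.antidiagonal 3).over K) = (!![(Matrix.diagonal d) 0 0, 0, (Matrix.diagonal d) 0 1; 0, η, 0; (Matrix.diagonal d) 1 0, 0, (Matrix.diagonal d) 1 1] : Matrix (Fin 3) (Fin 3) K))
    (hP0 : mapGL P (stdLattice K 3) = stdLattice K 3)
    {γ : unitaryGroupOfForm σ ((StdForm.antidiagonal 3).over K)} (γ₁ : GL (Fin 2) K) (u : GL (Fin 1) K)
    (hγ : (γ : GL (Fin 3) K) = P * endoGL (γ₁, u) * P⁻¹)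
    (hγU : γ₁ ∈ unitaryGroupOfForm σ (Matrix.diagonal d)) {d₀ : ℕ} (hodd : Odd d₀)
    (hdeep : ∀ i j, Valued.v (((γ₁ : Matrix (Fin 2) (Fin 2) K) - 1) i j) ≤ Valued.v ϖ ^ d₀)
    (hu : Valued.v ((u : Matrix (Fin 1) (Fin 1) K) 0 0 - 1) < Valued.v ϖ ^ d₀)
    (d₀' d₁' η' : 𝒪[K]) (hd₀' : (d₀' : K) = d 0) (hd₁' : (d₁' : K) = d 1) (hη' : (η' : K) = η) :
    ∃ (Ab : GL (Fin 3) 𝓀[K]) (Y₀ : Matrix (Fin 3) (Fin 3) 𝒪[K]) (T : Matrix (Fin 2) (Fin 2) 𝒪[K]) (B : Matrix (Fin 3) (Fin 3) 𝓀[K]),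
      (∀ i j, ((Y₀ i j : 𝒪[K]) : K) = (ϖ ^ d₀)⁻¹ * ((((γ : GL (Fin 3) K) : Matrix (Fin 3) (Fin 3) K) - 1) i j)) ∧
      (∀ i j, ((T i j : 𝒪[K]) : K) = (ϖ ^ d₀)⁻¹ * (((γ₁ : Matrix (Fin 2) (Fin 2) K) - 1) i j)) ∧
      ((Ab : Matrix (Fin 3) (Fin 3) 𝓀[K]))ᵀ * ((StdForm.antidiagonal 3).over 𝓀[K]) * (Ab : Matrix (Fin 3) (Fin 3) 𝓀[K]) =
        Matrix.diagonal ![IsLocalRing.residue 𝒪[K] d₀', IsLocalRing.residue 𝒪[K] η', IsLocalRing.residue 𝒪[K] d₁'] ∧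
      (∀ m, (![IsLocalRing.residue 𝒪[K] d₀', IsLocalRing.residue 𝒪[K] η', IsLocalRing.residue 𝒪[K] d₁'] : Fin 3 → 𝓀[K]) m ≠ 0) ∧
      quadraticChar 𝓀[K] (-(IsLocalRing.residue 𝒪[K] d₀' * IsLocalRing.residue 𝒪[K] d₁')) = -1 ∧
      ((Ab⁻¹ : GL (Fin 3) 𝓀[K]) : Matrix (Fin 3) (Fin 3) 𝓀[K]) * Y₀.map (IsLocalRing.residue 𝒪[K]) * (Ab : Matrix (Fin 3) (Fin 3) 𝓀[K]) = B ∧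
      B 1 0 = 0 ∧ B 1 2 = 0 ∧ B 0 1 = 0 ∧ B 2 1 = 0 ∧ B 1 1 = 0 ∧
      B 0 0 = IsLocalRing.residue 𝒪[K] (T 0 0) ∧ B 0 2 = IsLocalRing.residue 𝒪[K] (T 0 1) ∧
      B 2 0 = IsLocalRing.residue 𝒪[K] (T 1 0) ∧ B 2 2 = IsLocalRing.residue 𝒪[K] (T 1 1) ∧
      (![IsLocalRing.residue 𝒪[K] d₀', IsLocalRing.residue 𝒪[K] η', IsLocalRing.residue 𝒪[K] d₁'] : Fin 3 → 𝓀[K]) 0 * B 0 2 =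
        (![IsLocalRing.residue 𝒪[K] d₀', IsLocalRing.residue 𝒪[K] η', IsLocalRing.residue 𝒪[K] d₁'] : Fin 3 → 𝓀[K]) 2 * B 2 0 := by
  have hϖ0 : ϖ ≠ 0 := fun h0 => by rw [h0, map_zero] at hϖ; exact WithZero.coe_ne_zero hϖ.symm
  have hvϖ0 : Valued.v ϖ ≠ 0 := (Valuation.ne_zero_iff _).2 hϖ0
  have hvd0 : Valued.v ϖ ^ d₀ ≠ 0 := pow_ne_zero _ hvϖ0
  have hϖD0 : (ϖ ^ d₀ : K) ≠ 0 := pow_ne_zero _ hϖ0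
  have hres0 : ∀ x : 𝒪[K], IsLocalRing.residue 𝒪[K] x = 0 ↔ Valued.v (x : K) < 1 := residue_eq_zero_iff_v_lt_one
  obtain ⟨hPi, hPi'⟩ := (mapGL_stdLattice_eq_iff P).1 hP0
  obtain ⟨AO, AO', Ab, hmA, hmA', h1, h2', hAb, hAb'⟩ := exists_residualGL_of_isIntMatrix P hPi hPi'
  have hinj : Function.Injective (fun M : Matrix (Fin 3) (Fin 3) 𝒪[K] => M.map (Valued.integer K).subtype) :=
    Matrix.map_injective Subtype.coe_injective
  have hAb2 : ((Ab⁻¹ : GL (Fin 3) 𝓀[K]) : Matrix (Fin 3) (Fin 3) 𝓀[K]) * (Ab : Matrix (Fin 3) (Fin 3) 𝓀[K]) = 1 := by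
    rw [← Units.val_mul, inv_mul_cancel, Units.val_one]
  -- ### the integral leading matrices `T`, `λ`, `ι(T, λ)` and `Y₀ = AO·ι(T,λ)·AO'`
  have hbound : ∀ t : K, Valued.v t ≤ Valued.v ϖ ^ d₀ → (ϖ ^ d₀)⁻¹ * t ∈ 𝒪[K] := fun t ht => by
    refine (Valuation.mem_integer_iff _ _).2 ?_
    rw [map_mul, map_inv₀, map_pow]
    have h' := mul_le_mul' (le_refl ((Valued.v ϖ ^ d₀)⁻¹)) ht
    rwa [inv_mul_cancel₀ hvd0] at h'
  set T : Matrix (Fin 2) (Fin 2) 𝒪[K] := Matrix.of fun i j => (⟨(ϖ ^ d₀)⁻¹ * (((γ₁ : Matrix (Fin 2) (Fin 2) K) - 1) i j), hbound _ (hdeep i j)⟩ : 𝒪[K]) with hTdef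
  have hT : ∀ i j, ((T i j : 𝒪[K]) : K) = (ϖ ^ d₀)⁻¹ * (((γ₁ : Matrix (Fin 2) (Fin 2) K) - 1) i j) := fun i j => rfl
  set lam : 𝒪[K] := ⟨(ϖ ^ d₀)⁻¹ * ((u : Matrix (Fin 1) (Fin 1) K) 0 0 - 1), hbound _ hu.le⟩ with hlamdef
  have hlam0 : IsLocalRing.residue 𝒪[K] lam = 0 := by
    rw [hres0]
    change Valued.v ((ϖ ^ d₀)⁻¹ * ((u : Matrix (Fin 1) (Fin 1) K) 0 0 - 1)) < 1
    rw [map_mul, map_inv₀, map_pow]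
    have hpos : 0 < Valued.v ϖ ^ d₀ := zero_lt_iff.2 hvd0
    calc (Valued.v ϖ ^ d₀)⁻¹ * Valued.v ((u : Matrix (Fin 1) (Fin 1) K) 0 0 - 1) < (Valued.v ϖ ^ d₀)⁻¹ * Valued.v ϖ ^ d₀ :=
          mul_lt_mul_of_pos_left hu (inv_pos.2 hpos)
      _ = 1 := inv_mul_cancel₀ hvd0
  have hlamK : ((lam : 𝒪[K]) : K) = (ϖ ^ d₀)⁻¹ * ((u : Matrix (Fin 1) (Fin 1) K) 0 0 - 1) := rfl
  set ιO : Matrix (Fin 3) (Fin 3) 𝒪[K] := !![T 0 0, 0, T 0 1; 0, lam, 0; T 1 0, 0, T 1 1] with hιO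
  have hιmap : ιO.map (Valued.integer K).subtype = (ϖ ^ d₀)⁻¹ • ((((endoGL (γ₁, u) : GL (Fin 3) K) : Matrix (Fin 3) (Fin 3) K)) - 1) := by
    rw [coe_endoGL_sub_one_eq_endoShape]
    ext i j
    fin_cases i <;> fin_cases j <;> simp [hιO, hT, hlamK]
  set Y₀ : Matrix (Fin 3) (Fin 3) 𝒪[K] := AO * ιO * AO' with hY₀def
  have hPP : ((P : GL (Fin 3) K) : Matrix (Fin 3) (Fin 3) K) * ((P⁻¹ : GL (Fin 3) K) : Matrix (Fin 3) (Fin 3) K) = 1 := by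
    rw [← Units.val_mul, mul_inv_cancel, Units.val_one]
  have hγsub : (((γ : GL (Fin 3) K) : Matrix (Fin 3) (Fin 3) K) - 1) =
      ((P : GL (Fin 3) K) : Matrix (Fin 3) (Fin 3) K) * ((((endoGL (γ₁, u) : GL (Fin 3) K) : Matrix (Fin 3) (Fin 3) K)) - 1) * ((P⁻¹ : GL (Fin 3) K) : Matrix (Fin 3) (Fin 3) K) := by
    rw [hγ, Units.val_mul, Units.val_mul, Matrix.mul_sub, Matrix.sub_mul, Matrix.mul_one, hPP]
  have hY₀map : Y₀.map (Valued.integer K).subtype = (ϖ ^ d₀)⁻¹ • ((((γ : GL (Fin 3) K) : Matrix (Fin 3) (Fin 3) K) - 1)) := by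
    rw [hY₀def, Matrix.map_mul, Matrix.map_mul, hmA, hmA', hιmap, Matrix.mul_smul, Matrix.smul_mul, hγsub]
  have hY₀ : ∀ i j, ((Y₀ i j : 𝒪[K]) : K) = (ϖ ^ d₀)⁻¹ * ((((γ : GL (Fin 3) K) : Matrix (Fin 3) (Fin 3) K) - 1) i j) := fun i j => by
    have h := congrFun (congrFun hY₀map i) j
    rw [Matrix.map_apply, Matrix.smul_apply, smul_eq_mul] at h
    exact h
  -- ### `Ā⁻¹ Ȳ Ā = ι(T̄, λ̄)`
  set B : Matrix (Fin 3) (Fin 3) 𝓀[K] := ιO.map (IsLocalRing.residue 𝒪[K]) with hBdef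
  have hY : ((Ab⁻¹ : GL (Fin 3) 𝓀[K]) : Matrix (Fin 3) (Fin 3) 𝓀[K]) * Y₀.map (IsLocalRing.residue 𝒪[K]) * (Ab : Matrix (Fin 3) (Fin 3) 𝓀[K]) = B := by
    rw [hY₀def, Matrix.map_mul, Matrix.map_mul, ← hAb, ← hAb', ← hBdef, ← Matrix.mul_assoc, ← Matrix.mul_assoc, hAb2, Matrix.one_mul, Matrix.mul_assoc, hAb2,
      Matrix.mul_one]
  have hB10 : B 1 0 = 0 := by simp [hBdef, hιO]
  have hB12 : B 1 2 = 0 := by simp [hBdef, hιO]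
  have hB01 : B 0 1 = 0 := by simp [hBdef, hιO]
  have hB21 : B 2 1 = 0 := by simp [hBdef, hιO]
  have hB11 : B 1 1 = 0 := by simp [hBdef, hιO, hlam0]
  have hB00 : B 0 0 = IsLocalRing.residue 𝒪[K] (T 0 0) := by simp [hBdef, hιO]
  have hB02 : B 0 2 = IsLocalRing.residue 𝒪[K] (T 0 1) := by simp [hBdef, hιO]
  have hB20 : B 2 0 = IsLocalRing.residue 𝒪[K] (T 1 0) := by simp [hBdef, hιO]
  have hB22 : B 2 2 = IsLocalRing.residue 𝒪[K] (T 1 1) := by simp [hBdef, hιO]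
  -- ### the residual Gram `ᵗĀ J̄₀ Ā = diag(d̄₀, η̄, d̄₁)`: integrally `ᵗσ(AO)·J₀·AO = H♭`, then mod ϖ with `σ̄ = id`
  set AσO : Matrix (Fin 3) (Fin 3) 𝒪[K] := Matrix.of fun i j => (⟨σ ((AO i j : 𝒪[K]) : K), map_coe_mem_integer hvσ (AO i j)⟩ : 𝒪[K]) with hAσO
  have hmAσ : AσO.map (Valued.integer K).subtype = (((P : GL (Fin 3) K) : Matrix (Fin 3) (Fin 3) K)).map σ := by
    ext i j
    rw [← hmA]
    rfl
  set HbO : Matrix (Fin 3) (Fin 3) 𝒪[K] := !![d₀', 0, 0; 0, η', 0; 0, 0, d₁'] with hHbO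
  have hHbmap : HbO.map (Valued.integer K).subtype = (!![(Matrix.diagonal d) 0 0, 0, (Matrix.diagonal d) 0 1; 0, η, 0; (Matrix.diagonal d) 1 0, 0, (Matrix.diagonal d) 1 1] : Matrix (Fin 3) (Fin 3) K) := by
    ext i j
    fin_cases i <;> fin_cases j <;> simp [hHbO, hd₀', hd₁', hη', Matrix.diagonal]
  have hint : (AσO)ᵀ * ((StdForm.antidiagonal 3).over 𝒪[K]) * AO = HbO := hinj (by
    dsimp only
    rw [Matrix.map_mul, Matrix.map_mul, Matrix.transpose_map, hmAσ, hmA, StdForm.over_map', hHbmap, ← hP, formCongr])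
  have hAσres : AσO.map (IsLocalRing.residue 𝒪[K]) = AO.map (IsLocalRing.residue 𝒪[K]) := by
    ext i j
    rw [Matrix.map_apply, Matrix.map_apply, hAσO, Matrix.of_apply]
    exact residue_map_sigma_eq hvσ hres (AO i j)
  have hHbres : HbO.map (IsLocalRing.residue 𝒪[K]) = Matrix.diagonal ![IsLocalRing.residue 𝒪[K] d₀', IsLocalRing.residue 𝒪[K] η', IsLocalRing.residue 𝒪[K] d₁'] := by
    ext i j
    fin_cases i <;> fin_cases j <;> simp [hHbO, Matrix.diagonal]
  have hG : ((Ab : Matrix (Fin 3) (Fin 3) 𝓀[K]))ᵀ * ((StdForm.antidiagonal 3).over 𝓀[K]) * (Ab : Matrix (Fin 3) (Fin 3) 𝓀[K]) =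
      Matrix.diagonal ![IsLocalRing.residue 𝒪[K] d₀', IsLocalRing.residue 𝒪[K] η', IsLocalRing.residue 𝒪[K] d₁'] := by
    have h := congrArg (fun M : Matrix (Fin 3) (Fin 3) 𝒪[K] => M.map (IsLocalRing.residue 𝒪[K])) hint
    simp only [Matrix.map_mul, Matrix.transpose_map, hAσres, StdForm.over_map', hHbres] at h
    rw [hAb]; exact h
  -- ### the unit residues and the anisotropy of the root plane
  have hd₀v : Valued.v (d₀' : K) = 1 := by rw [hd₀']; exact hd 0
  have hd₁v : Valued.v (d₁' : K) = 1 := by rw [hd₁']; exact hd 1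
  have hηv : Valued.v (η' : K) = 1 := by rw [hη']; exact hη
  have hne : ∀ x : 𝒪[K], Valued.v (x : K) = 1 → IsLocalRing.residue 𝒪[K] x ≠ 0 := fun x hx h0 => by
    rw [hres0, hx] at h0; exact lt_irrefl _ h0
  have hδ0 : ∀ m, (![IsLocalRing.residue 𝒪[K] d₀', IsLocalRing.residue 𝒪[K] η', IsLocalRing.residue 𝒪[K] d₁'] : Fin 3 → 𝓀[K]) m ≠ 0 := by
    intro m; fin_cases m
    · exact hne d₀' hd₀v
    · exact hne η' hηv
    · exact hne d₁' hd₁v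
  have hχ : quadraticChar 𝓀[K] (-(IsLocalRing.residue 𝒪[K] d₀' * IsLocalRing.residue 𝒪[K] d₁')) = -1 := by
    have hnot : ¬ ∃ t : K, Valued.v t = 1 ∧ Valued.v ((d₀' : K) + t * σ t * (d₁' : K)) < 1 := by
      rintro ⟨t, ht1, hlt⟩
      have h := hanis₀ t ht1.le
      rw [← hd₀', ← hd₁', show (d₀' : K) + (d₁' : K) * (σ t * t) = (d₀' : K) + t * σ t * (d₁' : K) by ring] at h
      exact (ne_of_lt hlt) h
    rw [exists_unit_v_add_mul_norm_mul_lt_one_iff_quadraticChar hvσ hres d₀' d₁' hd₀v hd₁v] at hnot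
    exact (quadraticChar_eq_neg_one_iff_not_one (neg_ne_zero.2 (mul_ne_zero (hne d₀' hd₀v) (hne d₁' hd₁v)))).2 hnot
  -- ### self-adjointness at odd depth
  have hadj := residue_diag_mul_leading_offDiag_eq_of_odd hvσ hσϖ hϖ hres hd (γ₁ : Matrix (Fin 2) (Fin 2) K) hγU hodd T hT d₀' d₁' hd₀' hd₁'
  refine ⟨Ab, Y₀, T, B, hY₀, hT, hG, hδ0, hχ, hY, hB10, hB12, hB01, hB21, hB11, hB00, hB02, hB20, hB22, ?_⟩
  rw [hB02, hB20]
  simpa using hadj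

set_option maxHeartbeats 800000 in
-- budget only: the long conclusion telescope.
/-- **THE RESIDUAL FRAME AT THE TIE (regimes A-odd ∕ C), with the `hirr` binder in ★ p849444's 2-free spelling**: §3 plus, when `χ_{γ₁}` has no root in `K`,
`|tr² − 4det|(γ₁) = |ϖ|^{2d₀}`, `|2| = 1` and principal units are squares, the residual irreducibility **`χ((B₀₀ − B₂₂)² + 4·B₀₂B₂₀) = −1`** (§1 rewritten through `B = ι(T̄, 0)`).
So the aniso A-odd∕C root census is ★ `natCard_params_blockFrame_null_eq'` ∕ `two_mul_natCard_params_blockFrame_quadraticChar_eq'` by `exact` on these binders.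
[cite: Kottwitz1986, §3] [cite: Rogawski1990, §4.9 Prop. 4.9.1 (b) p. 55, Lemma 4.9.3 p. 56] [cite: Serre1979, Ch. II §4 Prop. 7] -/
theorem exists_residualFrame_of_coe_eq_conj_endoGL_of_tie [Fintype 𝓀[K]] [DecidableEq 𝓀[K]]
    (hvσ : ∀ a, Valued.v (σ a) = Valued.v a) (hres : ∀ x : K, Valued.v x ≤ 1 → Valued.v (σ x - x) < 1) (hσϖ : σ ϖ = -ϖ)
    (hϖ : Valued.v ϖ = WithZero.exp (-1 : ℤ)) (h2 : Valued.v (2 : K) = 1) (hsq : ∀ t : K, Valued.v (t - 1) < 1 → IsSquare t)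
    {d : Fin 2 → K} {η : K} (hd : ∀ i, Valued.v (d i) = 1) (hη : Valued.v η = 1)
    (hanis₀ : ∀ c : K, Valued.v c ≤ 1 → Valued.v (d 0 + d 1 * (σ c * c)) = 1)
    (P : GL (Fin 3) K)
    (hP : formCongr σ P ((StdForm.antidiagonal 3).over K) = (!![(Matrix.diagonal d) 0 0, 0, (Matrix.diagonal d) 0 1; 0, η, 0; (Matrix.diagonal d) 1 0, 0, (Matrix.diagonal d) 1 1] : Matrix (Fin 3) (Fin 3) K))
    (hP0 : mapGL P (stdLattice K 3) = stdLattice K 3)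
    {γ : unitaryGroupOfForm σ ((StdForm.antidiagonal 3).over K)} (γ₁ : GL (Fin 2) K) (u : GL (Fin 1) K)
    (hγ : (γ : GL (Fin 3) K) = P * endoGL (γ₁, u) * P⁻¹)
    (hγU : γ₁ ∈ unitaryGroupOfForm σ (Matrix.diagonal d))
    (hirr : ¬ ∃ x : K, ((γ₁ : Matrix (Fin 2) (Fin 2) K).charpoly).IsRoot x) {d₀ : ℕ} (hodd : Odd d₀)
    (hdeep : ∀ i j, Valued.v (((γ₁ : Matrix (Fin 2) (Fin 2) K) - 1) i j) ≤ Valued.v ϖ ^ d₀)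
    (hdisc : Valued.v ((γ₁ : Matrix (Fin 2) (Fin 2) K).trace ^ 2 - 4 * (γ₁ : Matrix (Fin 2) (Fin 2) K).det) = Valued.v ϖ ^ (2 * d₀))
    (hu : Valued.v ((u : Matrix (Fin 1) (Fin 1) K) 0 0 - 1) < Valued.v ϖ ^ d₀)
    (d₀' d₁' η' : 𝒪[K]) (hd₀' : (d₀' : K) = d 0) (hd₁' : (d₁' : K) = d 1) (hη' : (η' : K) = η) :
    ∃ (Ab : GL (Fin 3) 𝓀[K]) (Y₀ : Matrix (Fin 3) (Fin 3) 𝒪[K]) (T : Matrix (Fin 2) (Fin 2) 𝒪[K]) (B : Matrix (Fin 3) (Fin 3) 𝓀[K]),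
      (∀ i j, ((Y₀ i j : 𝒪[K]) : K) = (ϖ ^ d₀)⁻¹ * ((((γ : GL (Fin 3) K) : Matrix (Fin 3) (Fin 3) K) - 1) i j)) ∧
      (∀ i j, ((T i j : 𝒪[K]) : K) = (ϖ ^ d₀)⁻¹ * (((γ₁ : Matrix (Fin 2) (Fin 2) K) - 1) i j)) ∧
      ((Ab : Matrix (Fin 3) (Fin 3) 𝓀[K]))ᵀ * ((StdForm.antidiagonal 3).over 𝓀[K]) * (Ab : Matrix (Fin 3) (Fin 3) 𝓀[K]) =
        Matrix.diagonal ![IsLocalRing.residue 𝒪[K] d₀', IsLocalRing.residue 𝒪[K] η', IsLocalRing.residue 𝒪[K] d₁'] ∧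
      (∀ m, (![IsLocalRing.residue 𝒪[K] d₀', IsLocalRing.residue 𝒪[K] η', IsLocalRing.residue 𝒪[K] d₁'] : Fin 3 → 𝓀[K]) m ≠ 0) ∧
      quadraticChar 𝓀[K] (-(IsLocalRing.residue 𝒪[K] d₀' * IsLocalRing.residue 𝒪[K] d₁')) = -1 ∧
      ((Ab⁻¹ : GL (Fin 3) 𝓀[K]) : Matrix (Fin 3) (Fin 3) 𝓀[K]) * Y₀.map (IsLocalRing.residue 𝒪[K]) * (Ab : Matrix (Fin 3) (Fin 3) 𝓀[K]) = B ∧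
      B 1 0 = 0 ∧ B 1 2 = 0 ∧ B 0 1 = 0 ∧ B 2 1 = 0 ∧ B 1 1 = 0 ∧
      B 0 0 = IsLocalRing.residue 𝒪[K] (T 0 0) ∧ B 0 2 = IsLocalRing.residue 𝒪[K] (T 0 1) ∧
      B 2 0 = IsLocalRing.residue 𝒪[K] (T 1 0) ∧ B 2 2 = IsLocalRing.residue 𝒪[K] (T 1 1) ∧
      (![IsLocalRing.residue 𝒪[K] d₀', IsLocalRing.residue 𝒪[K] η', IsLocalRing.residue 𝒪[K] d₁'] : Fin 3 → 𝓀[K]) 0 * B 0 2 =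
        (![IsLocalRing.residue 𝒪[K] d₀', IsLocalRing.residue 𝒪[K] η', IsLocalRing.residue 𝒪[K] d₁'] : Fin 3 → 𝓀[K]) 2 * B 2 0 ∧
      quadraticChar 𝓀[K] ((B 0 0 - B 2 2) ^ 2 + 4 * (B 0 2 * B 2 0)) = -1 := by
  obtain ⟨Ab, Y₀, T, B, hY₀, hT, hG, hδ0, hχ, hY, hB10, hB12, hB01, hB21, hB11, hB00, hB02, hB20, hB22, hadj⟩ :=
    exists_residualFrame_of_coe_eq_conj_endoGL hvσ hres hσϖ hϖ hd hη hanis₀ P hP hP0 γ₁ u hγ hγU hodd hdeep hu d₀' d₁' η' hd₀' hd₁' hη'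
  refine ⟨Ab, Y₀, T, B, hY₀, hT, hG, hδ0, hχ, hY, hB10, hB12, hB01, hB21, hB11, hB00, hB02, hB20, hB22, hadj, ?_⟩
  rw [hB00, hB22, hB02, hB20]
  exact quadraticChar_residue_leadingDisc_eq_neg_one h2 hsq hϖ (γ₁ : Matrix (Fin 2) (Fin 2) K) hirr hdisc T hT

/-! ## §4 (ED. 2) The discriminant class of a residual frame: `χ(δ₀δ₁δ₂) = χ(−1)` -/

/-- **THE DISCRIMINANT CLASS OF A RESIDUAL FRAME.**  For `Ā ∈ GL₃(k)` with `ᵗĀ·J̄₀·Ā = diag δ`: `χ(δ₀·δ₁·δ₂) = χ(−1)` — `det J̄₀ = −1`, so `δ₀δ₁δ₂ = −(det Ā)²`.  (For the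
anisotropic literal's frame of §3 this is `χ(d̄₀·η̄·d̄₁) = χ(−1)`, the class key of ★ p849444's `χ(2c₀δ_{i₀}δ_jδ_l)`.) [cite: Rogawski1990, §1.9 p. 8, §4.9 p. 55]
[cite: IrelandRosen1990, Ch. 8 §1] -/
theorem quadraticChar_prod_eq_quadraticChar_neg_one_of_frame {k : Type*} [Field k] [Fintype k] [DecidableEq k]
    (A : GL (Fin 3) k) (δ : Fin 3 → k)
    (hG : ((A : Matrix (Fin 3) (Fin 3) k))ᵀ * ((StdForm.antidiagonal 3).over k) * (A : Matrix (Fin 3) (Fin 3) k) = Matrix.diagonal δ) :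
    quadraticChar k (δ 0 * δ 1 * δ 2) = quadraticChar k (-1) := by
  have hdet := congrArg Matrix.det hG
  have hJ : ((StdForm.antidiagonal 3).over k).det = -1 := by
    rw [UnitaryGroup.antidiagonal_three_over_eq, Matrix.det_fin_three]; simp
  rw [Matrix.det_mul, Matrix.det_mul, Matrix.det_transpose, hJ, Matrix.det_diagonal, Fin.prod_univ_three] at hdet
  have hA : (A : Matrix (Fin 3) (Fin 3) k).det ≠ 0 := by
    intro h0
    have h1 := congrArg Matrix.det (show (A : Matrix (Fin 3) (Fin 3) k) * ((A⁻¹ : GL (Fin 3) k) : Matrix (Fin 3) (Fin 3) k) = 1 by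
      rw [← Units.val_mul, mul_inv_cancel, Units.val_one])
    rw [Matrix.det_mul, h0, zero_mul, Matrix.det_one] at h1
    exact zero_ne_one h1
  have e : δ 0 * δ 1 * δ 2 = -1 * (A : Matrix (Fin 3) (Fin 3) k).det ^ 2 := by rw [← hdet]; ring
  rw [e, map_mul, map_pow, quadraticChar_sq_one hA, mul_one]

end Literature.NumberTheory.Rogawski1990.TypeOneRamifiedJunction

end
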